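import Literature.NumberTheory.ModularForms.RademacherPhiCuspFormula
import Mathlib.NumberTheory.Padics.PadicNumbers
import Summits.BirchSwinnertonDyer.BirchSwinnertonDyer.Theorems.EisensteinDepletionAtTwoStarStabCoeff
import HarnessLib

/-!
# Route `EisensteinDepletionAtTwo`, crux E1M `DepletedLambdaLawAtTwoMod` (item stmt-BirchSwinnertonDyer-20341),
# line `star`, Eisenstein half — §C: cusp values of the stabilised Eisenstein period function on the Bézout matrices
# of `b/2^m`, their `α = 1` combinations, `2`-adic integrality, and the shifts `a ↦ a·5^{±1}` of the `η = +1` classes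

Cell `bsd-rank2`, seat `bsd-rank2-eng-2` GEN 8. THEOREMS ONLY — no definition, no named fact, no `sorry`. HONEST FRAMING: closed-form
bookkeeping of Dedekind–Rademacher sums over the definitions of `Theorems/EisensteinDepletionAtTwoStarDefs.lean` (p554176) and
the Literature cusp formula `sum_rademacherPhi_bezout_conj` (lit GEN 20, p552106); inputs of the finite-level form (★-EisFin) of the
Eisenstein half of (★) (evidence #39 on the item). Nothing here reads an analytic rank; (★)/E1M are NOT proved; BSD is not proved by
any of this (PARTITION D-0054: none — r_an ≥ 2 axis S0, door T-r3₂). The lead's skeleton `Cruxes/…/Lines/star.lean` v2.5 proves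
N1/N1′/N3-ii in-file over its local copies of the same definitions; this is the importable Theorems-side version.

* `stabEisensteinPeriod_gammaEntries` (N1): `φ_β(γ_{b,2^m}) = −12·∑_t c_t s(tb,2^m) + c_β·N·y_{b,m}/2^m` (`b` odd, `c_β = ∑ c_t/t`,
  `y_{b,m} = gcdB(2^m, bN)`); `stabEisCuspDiff_closedForm` (N1′); `stabEisensteinPeriod_sub_level` (the `α = 1` combination
  `φ_β(γ_{X,2^m}) − φ_β(γ_{X̄,2^{m−1}}) = −12·E(m,X) + c_β·B(m,X)`, `E` = Dedekind differences, `B` = Bézout boundary term).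
* `exists_int_rademacherPhi_gammaEntries`, `norm_stabEisensteinPeriod_gammaEntries_le_one`, `norm_stabEisCuspDiff_le_one`:
  `Φ ∈ ℤ` on the conjugated Bézout matrices (`det = 1`), so `φ_β(γ_{b,2^m}) ∈ ℤ₂` (`c_t ∈ ℤ₂`).
* `two_pow_dvd_bezout_shift`: `2^k ∣ N·(y_{X,k} − c·y_{X',k})` whenever `2^k ∣ X' − cX` — for ANY Bézout representatives.
* the `η = +1` classes under `a ↦ a·5`, `a ↦ a·5⁻¹`: `dvd_val_mul_five`, `dvd_val_mul_five_inv`, `val_shift_mod_four`.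

References: G. Stevens, *Arithmetic on Modular Curves* (1982), §2.5, §5.4 [Stevens1982]; H. Rademacher, E. Grosswald, *Dedekind Sums*
(1972), Ch. 4 A [RademacherGrosswald1972]; B. Mazur, J. Tate, J. Teitelbaum, Invent. Math. 84 (1986), §I.10–I.11 [MazurTateTeitelbaum1986Invent].
-/

set_option linter.dupNamespace false
set_option autoImplicit false

noncomputable section

open scoped Classical

namespace Summit.BirchSwinnertonDyer.BirchSwinnertonDyer.Theorems.DepletionAtTwo

open Literature.NumberTheory.ModularForms

section CuspValues

variable {N : ℕ} {β : ℕ → ℕ}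

/-- `gcd(2^m, b·N) = 1` for odd `b` and odd `N`. [folklore] -/
theorem int_gcd_two_pow_eq_one (hodd : Odd N) {b : ℤ} (hb : Odd b) (m : ℕ) :
    Int.gcd ((2 ^ m : ℕ) : ℤ) (b * N) = 1 := by
  rw [Int.gcd_eq_natAbs, Int.natAbs_natCast, Int.natAbs_mul, Int.natAbs_natCast]
  exact Nat.Coprime.pow_left m (Nat.coprime_two_left.mpr ((Int.natAbs_odd.mpr hb).mul hodd))

/-- **Cusp values of the stabilised Eisenstein period function on the Bézout matrix of `b/2^m`** (`b` odd, `m ≥ 1`,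
odd level `N`, admissible `β`):
`φ_β(γ_{b,2^m}) = −12·∑_{t ∣ N} c_t·s(tb, 2^m) + c_β·N·y_{b,m}/2^m`, `y_{b,m} = gcdB(2^m, bN)`, `c_β = ∑_t c_t/t`
(lit's `sum_rademacherPhi_bezout_conj` with `∑ c_t = 0 = ∑ c_t t`; the lead's in-skeleton N1).
[cite: Stevens1982, §2.5 eq. (2.5.3) (PDF p. 38)] [cite: RademacherGrosswald1972, Ch. 4 A, eq. (59)] -/
theorem stabEisensteinPeriod_gammaEntries (hodd : Odd N) (hadm : IsAdmissibleStabData N β) {m : ℕ} (hm : 1 ≤ m)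
    {b : ℤ} (hb : Odd b) :
    stabEisensteinPeriod N β (gammaEntries N b ((2 ^ m : ℕ) : ℤ)).1 (gammaEntries N b ((2 ^ m : ℕ) : ℤ)).2.1
        (gammaEntries N b ((2 ^ m : ℕ) : ℤ)).2.2.1 (gammaEntries N b ((2 ^ m : ℕ) : ℤ)).2.2.2 =
      -12 * ∑ t ∈ N.divisors, stabCoeff N β t * dedekindSum (t * b) (2 ^ m) +
        (∑ t ∈ N.divisors, stabCoeff N β t / t) * ((N : ℚ) * Int.gcdB ((2 ^ m : ℕ) : ℤ) (b * N) / (2 ^ m : ℕ)) := by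
  have hN : 0 < N := Nat.pos_of_ne_zero fun h ↦ by simp [h] at hodd
  have hd : 1 < 2 ^ m := Nat.one_lt_two_pow (by omega)
  simp only [stabEisensteinPeriod, gammaEntries]
  exact sum_rademacherPhi_bezout_conj hN hd (int_gcd_two_pow_eq_one hodd hb m) N.divisors
    (fun t ht ↦ Nat.dvd_of_mem_divisors ht) (stabCoeff N β) (sum_divisors_stabCoeff_eq_zero hN.ne' hadm)
    (sum_divisors_stabCoeff_mul_self_eq_zero hN.ne' hadm)

/-- The same, read through `stabEisCuspDiff`: `v(m, b) = φ_β(γ_{b,2^m}) − φ_β(γ_{1,2^m})` in closed form (`b` odd).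
[cite: Stevens1982, §2.5 (PDF p. 38)] -/
theorem stabEisCuspDiff_closedForm (hodd : Odd N) (hadm : IsAdmissibleStabData N β) {m : ℕ} (hm : 1 ≤ m)
    {b : ℤ} (hb : Odd b) :
    stabEisCuspDiff N β m b =
      -12 * ∑ t ∈ N.divisors, stabCoeff N β t * (dedekindSum (t * b) (2 ^ m) - dedekindSum (t * 1) (2 ^ m)) +
        (∑ t ∈ N.divisors, stabCoeff N β t / t) * (N : ℚ) *
          ((Int.gcdB ((2 ^ m : ℕ) : ℤ) (b * N) - Int.gcdB ((2 ^ m : ℕ) : ℤ) (1 * N)) / (2 ^ m : ℕ)) := by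
  have h1 := stabEisensteinPeriod_gammaEntries hodd hadm hm hb
  have h2 := stabEisensteinPeriod_gammaEntries hodd hadm hm odd_one
  unfold stabEisCuspDiff
  simp only []
  rw [h1, h2, Finset.mul_sum, Finset.mul_sum, Finset.mul_sum]
  rw [show ∀ (x y u v : ℚ), (x + y) - (u + v) = (x - u) + (y - v) from fun _ _ _ _ ↦ by ring,
    ← Finset.sum_sub_distrib]
  congr 1
  · exact Finset.sum_congr rfl fun t _ ↦ by ring
  · ring

/-- **`Φ` is `ℤ`-valued on the level-`t` conjugate of the Bézout matrix of `b/2^m`** (`b` odd, odd `N`, `t ∣ N`): the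
conjugated matrix `(x, tb; −Ny/t, 2^m)` has determinant `x·2^m + bNy = 1`.
[cite: RademacherGrosswald1972, Ch. 4 A (pp. 49–50, integrality of Φ)] -/
theorem exists_int_rademacherPhi_gammaEntries (hodd : Odd N) (m : ℕ) {b : ℤ} (hb : Odd b) {t : ℕ} (ht : t ∈ N.divisors) :
    ∃ z : ℤ, rademacherPhi (Int.gcdA ((2 ^ m : ℕ) : ℤ) (b * N)) (t * b)
      ((-(N : ℤ) * Int.gcdB ((2 ^ m : ℕ) : ℤ) (b * N)) / t) ((2 ^ m : ℕ) : ℤ) = z := by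
  set x := Int.gcdA ((2 ^ m : ℕ) : ℤ) (b * N) with hx
  set y := Int.gcdB ((2 ^ m : ℕ) : ℤ) (b * N) with hy
  have hbez : ((2 ^ m : ℕ) : ℤ) * x + b * N * y = 1 := by
    have e := Int.gcd_eq_gcd_ab ((2 ^ m : ℕ) : ℤ) (b * N)
    rw [int_gcd_two_pow_eq_one hodd hb m, Nat.cast_one] at e
    linear_combination -e
  obtain ⟨n', hn'⟩ := Nat.dvd_of_mem_divisors ht
  have ht0 : (t : ℤ) ≠ 0 := by
    have := Nat.pos_of_mem_divisors ht; omega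
  have hdiv : (-(N : ℤ) * y) / t = -(n' : ℤ) * y := by
    rw [hn', Nat.cast_mul, show -((t : ℤ) * n') * y = t * (-(n' : ℤ) * y) by ring, Int.mul_ediv_cancel_left _ ht0]
  have hdet : x * ((2 ^ m : ℕ) : ℤ) - (t : ℤ) * b * ((-(N : ℤ) * y) / t) = 1 := by
    rw [hdiv]
    rw [hn', Nat.cast_mul] at hbez
    linear_combination hbez
  exact rademacherPhi_mem_int hdet

/-- **`φ_β(γ_{b,2^m}) ∈ ℤ₂`** at odd level (`c_t ∈ ℤ₂`, `Φ ∈ ℤ` on each conjugate).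
[cite: RademacherGrosswald1972, Ch. 4 A (pp. 49–50)] [cite: Stevens1982, §2.5 (PDF p. 38)] -/
theorem norm_stabEisensteinPeriod_gammaEntries_le_one (hodd : Odd N) (β : ℕ → ℕ) (m : ℕ) {b : ℤ} (hb : Odd b) :
    ‖((stabEisensteinPeriod N β (gammaEntries N b ((2 ^ m : ℕ) : ℤ)).1 (gammaEntries N b ((2 ^ m : ℕ) : ℤ)).2.1
        (gammaEntries N b ((2 ^ m : ℕ) : ℤ)).2.2.1 (gammaEntries N b ((2 ^ m : ℕ) : ℤ)).2.2.2 : ℚ) : ℚ_[2])‖ ≤ 1 := by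
  simp only [stabEisensteinPeriod, gammaEntries, Rat.cast_sum, Rat.cast_mul]
  refine IsUltrametricDist.norm_sum_le_of_forall_le_of_nonneg zero_le_one fun t ht ↦ ?_
  obtain ⟨z, hz⟩ := exists_int_rademacherPhi_gammaEntries hodd m hb ht
  rw [hz, norm_mul, Rat.cast_intCast]
  exact mul_le_one₀ (norm_stabCoeff_le_one hodd t) (norm_nonneg _) (Padic.norm_int_le_one (p := 2) z)

/-- `v(m, b) = φ_β(γ_{b,2^m}) − φ_β(γ_{1,2^m}) ∈ ℤ₂` for odd `b` at odd level. [cite: Stevens1982, §2.5 (PDF p. 38)] -/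
theorem norm_stabEisCuspDiff_le_one (hodd : Odd N) (β : ℕ → ℕ) (m : ℕ) {b : ℤ} (hb : Odd b) :
    ‖((stabEisCuspDiff N β m b : ℚ) : ℚ_[2])‖ ≤ 1 := by
  have h1 := norm_stabEisensteinPeriod_gammaEntries_le_one hodd β m hb
  have h2 := norm_stabEisensteinPeriod_gammaEntries_le_one hodd β m odd_one
  unfold stabEisCuspDiff
  simp only [Rat.cast_sub]
  rw [sub_eq_add_neg]
  exact (Padic.nonarchimedean _ _).trans (max_le h1 (by rwa [norm_neg]))

end CuspValues


/-! ## §D. The `α = 1` combination and the class shifts -/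

section Pointwise

variable {N : ℕ} {β : ℕ → ℕ}

open Literature.NumberTheory.EllipticCurves

/-- An odd natural number stays odd modulo `2^k` for `k ≥ 1`. [folklore] -/
theorem odd_mod_two_pow {A k : ℕ} (hA : Odd A) (hk : 1 ≤ k) : Odd (A % 2 ^ k) := by
  rw [Nat.odd_iff] at hA ⊢
  rw [Nat.mod_mod_of_dvd A (dvd_pow_self 2 (by omega : k ≠ 0)), hA]

/-- **The `α = 1` combination of two consecutive cusp values in closed form**: for odd `X`, `m ≥ 2`,
`φ_β(γ_{X,2^m}) − φ_β(γ_{X̄,2^{m−1}}) = −12·E(m,X) + c_β·B(m,X)` with `X̄ = X mod 2^{m−1}`,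
`E(m,X) = ∑_t c_t (s(tX,2^m) − s(tX,2^{m−1}))`, `B(m,X) = N·(y_{X,m}/2^m − y_{X̄,m−1}/2^{m−1})`
(`s(tX̄, 2^{m−1}) = s(tX, 2^{m−1})` by periodicity). [cite: Stevens1982, §2.5 and §5.4 (PDF pp. 38, 72–73)]
[cite: MazurTateTeitelbaum1986Invent, §I.10 (10.1)] -/
theorem stabEisensteinPeriod_sub_level (hodd : Odd N) (hadm : IsAdmissibleStabData N β) {m : ℕ} (hm : 2 ≤ m)
    {X : ℕ} (hX : Odd X) :
    stabEisensteinPeriod N β (gammaEntries N X ((2 ^ m : ℕ) : ℤ)).1 (gammaEntries N X ((2 ^ m : ℕ) : ℤ)).2.1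
        (gammaEntries N X ((2 ^ m : ℕ) : ℤ)).2.2.1 (gammaEntries N X ((2 ^ m : ℕ) : ℤ)).2.2.2 -
      stabEisensteinPeriod N β (gammaEntries N ((X % 2 ^ (m - 1) : ℕ) : ℤ) ((2 ^ (m - 1) : ℕ) : ℤ)).1
        (gammaEntries N ((X % 2 ^ (m - 1) : ℕ) : ℤ) ((2 ^ (m - 1) : ℕ) : ℤ)).2.1
        (gammaEntries N ((X % 2 ^ (m - 1) : ℕ) : ℤ) ((2 ^ (m - 1) : ℕ) : ℤ)).2.2.1
        (gammaEntries N ((X % 2 ^ (m - 1) : ℕ) : ℤ) ((2 ^ (m - 1) : ℕ) : ℤ)).2.2.2 =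
      -12 * ∑ t ∈ N.divisors, stabCoeff N β t *
          (dedekindSum (t * X : ℤ) (2 ^ m) - dedekindSum (t * X : ℤ) (2 ^ (m - 1))) +
        (∑ t ∈ N.divisors, stabCoeff N β t / t) * ((N : ℚ) *
          ((Int.gcdB ((2 ^ m : ℕ) : ℤ) (X * N) : ℚ) / (2 ^ m : ℕ) -
            (Int.gcdB ((2 ^ (m - 1) : ℕ) : ℤ) (((X % 2 ^ (m - 1) : ℕ) : ℤ) * N) : ℚ) / (2 ^ (m - 1) : ℕ))) := by
  have hX' : Odd (((X % 2 ^ (m - 1) : ℕ) : ℤ)) := by exact_mod_cast odd_mod_two_pow hX (by omega)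
  have hXi : Odd (X : ℤ) := by exact_mod_cast hX
  rw [stabEisensteinPeriod_gammaEntries hodd hadm (by omega) hXi,
    stabEisensteinPeriod_gammaEntries hodd hadm (by omega) hX']
  -- `s(t·X̄, 2^{m−1}) = s(t·X, 2^{m−1})`
  have hper : ∀ t ∈ N.divisors, dedekindSum (t * ((X % 2 ^ (m - 1) : ℕ) : ℤ)) (2 ^ (m - 1)) =
      dedekindSum (t * X : ℤ) (2 ^ (m - 1)) := by
    intro t _
    refine dedekindSum_congr_of_emod_eq ?_
    push_cast
    rw [Int.mul_emod, Int.emod_emod_of_dvd _ (dvd_refl _), ← Int.mul_emod]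
  rw [Finset.mul_sum, Finset.mul_sum, Finset.mul_sum]
  rw [show ∀ (x y u v : ℚ), (x + y) - (u + v) = (x - u) + (y - v) from fun _ _ _ _ ↦ by ring,
    ← Finset.sum_sub_distrib]
  congr 1
  · refine Finset.sum_congr rfl fun t ht ↦ ?_
    rw [hper t ht]; ring
  · ring

/-- **Bézout representatives under a shift `X ↦ cX`**: if `2^k ∣ X' − c·X` with `X, X'` odd and `N` odd, then
`2^k ∣ N·(y_{X,k} − c·y_{X',k})` for the Bézout coefficients `y_{Z,k} = gcdB(2^k, Z·N)` (`Z·N·y_{Z,k} ≡ 1`), whatever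
representatives the extended Euclidean algorithm returns (`Ny − cNy' = −Ny(X'Ny'−1) + cNy'(XNy−1) + N²yy'(X'−cX)`). [folklore] -/
theorem two_pow_dvd_bezout_shift (hodd : Odd N) (k : ℕ) {X X' : ℤ} (hX : Odd X) (hX' : Odd X') (c : ℤ)
    (hc : ((2 ^ k : ℕ) : ℤ) ∣ X' - c * X) :
    ((2 ^ k : ℕ) : ℤ) ∣ (N : ℤ) * (Int.gcdB ((2 ^ k : ℕ) : ℤ) (X * N) - c * Int.gcdB ((2 ^ k : ℕ) : ℤ) (X' * N)) := by
  have e := Int.gcd_eq_gcd_ab ((2 ^ k : ℕ) : ℤ) (X * N)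
  have e' := Int.gcd_eq_gcd_ab ((2 ^ k : ℕ) : ℤ) (X' * N)
  rw [int_gcd_two_pow_eq_one hodd hX k, Nat.cast_one] at e
  rw [int_gcd_two_pow_eq_one hodd hX' k, Nat.cast_one] at e'
  set M : ℤ := ((2 ^ k : ℕ) : ℤ) with hM
  set y := Int.gcdB M (X * N) with hy
  set y' := Int.gcdB M (X' * N) with hy'
  -- the two Bézout identities
  have hu : M ∣ X * N * y - 1 := ⟨-Int.gcdA M (X * N), by linear_combination -e⟩
  have hu' : M ∣ X' * N * y' - 1 := ⟨-Int.gcdA M (X' * N), by linear_combination -e'⟩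
  have hid : (N : ℤ) * (y - c * y') =
      -(N * y) * (X' * N * y' - 1) + c * N * y' * (X * N * y - 1) + N * N * y * y' * (X' - c * X) := by ring
  rw [hid]
  exact dvd_add (dvd_add (dvd_mul_of_dvd_right hu' _) (dvd_mul_of_dvd_right hu _)) (dvd_mul_of_dvd_right hc _)

end Pointwise

section Classes

/-- For `m ≥ 3`, `((5 : ℕ) : ℤ/2^m)` has value `5`. [folklore] -/
theorem val_five {m : ℕ} (hm : 3 ≤ m) : ((5 : ℕ) : ZMod (2 ^ m)).val = 5 := by
  rw [ZMod.val_natCast]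
  exact Nat.mod_eq_of_lt (lt_of_lt_of_le (by norm_num) (Nat.pow_le_pow_right (by norm_num) hm : 2 ^ 3 ≤ 2 ^ m))

/-- `5` is invertible modulo `2^m`: `5 · 5⁻¹ = 1` in `ℤ/2^m`. [folklore] -/
theorem five_mul_inv {m : ℕ} : ((5 : ℕ) : ZMod (2 ^ m)) * ((5 : ℕ) : ZMod (2 ^ m))⁻¹ = 1 :=
  ZMod.coe_mul_inv_eq_one 5 (Nat.Coprime.pow_right m (by norm_num : Nat.Coprime 5 2))

/-- `4 ∣ 2^m` for `m ≥ 2`. [folklore] -/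
theorem four_dvd_two_pow {m : ℕ} (hm : 2 ≤ m) : (4 : ℤ) ∣ ((2 ^ m : ℕ) : ℤ) := by
  obtain ⟨k, rfl⟩ := Nat.exists_eq_add_of_le hm
  exact ⟨2 ^ k, by push_cast; ring⟩

/-- The shifted class `a·5`: `2^m ∣ (a·5).val − 5·a.val` (`m ≥ 3`). [folklore] -/
theorem dvd_val_mul_five {m : ℕ} (hm : 3 ≤ m) (a : ZMod (2 ^ m)) :
    ((2 ^ m : ℕ) : ℤ) ∣ ((a * ((5 : ℕ) : ZMod (2 ^ m))).val : ℤ) - 5 * (a.val : ℤ) := by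
  haveI : NeZero (2 ^ m) := ⟨pow_ne_zero _ two_ne_zero⟩
  have hv : (a * ((5 : ℕ) : ZMod (2 ^ m))).val = (a.val * 5) % 2 ^ m := by
    rw [ZMod.val_mul, val_five hm]
  rw [hv]
  have h := (Nat.mod_modEq (a.val * 5) (2 ^ m)).dvd
  rw [show ((a.val * 5 : ℕ) : ℤ) = 5 * (a.val : ℤ) by push_cast; ring] at h
  have h' := dvd_neg.mpr h
  rwa [neg_sub] at h'

/-- The shifted class `a·5⁻¹`: `2^m ∣ a.val − 5·(a·5⁻¹).val` (`m ≥ 3`). [folklore] -/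
theorem dvd_val_mul_five_inv {m : ℕ} (hm : 3 ≤ m) (a : ZMod (2 ^ m)) :
    ((2 ^ m : ℕ) : ℤ) ∣ (a.val : ℤ) - 5 * ((a * ((5 : ℕ) : ZMod (2 ^ m))⁻¹).val : ℤ) := by
  have hba : a * ((5 : ℕ) : ZMod (2 ^ m))⁻¹ * ((5 : ℕ) : ZMod (2 ^ m)) = a := by
    rw [mul_assoc, mul_comm (((5 : ℕ) : ZMod (2 ^ m))⁻¹), five_mul_inv, mul_one]
  have h := dvd_val_mul_five hm (a * ((5 : ℕ) : ZMod (2 ^ m))⁻¹)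
  rwa [hba] at h

/-- On the `η = +1` classes (`a.val ≡ 1 (mod 4)`, `m ≥ 3`) the shifted classes `a·5` and `a·5⁻¹` are again `η = +1` classes.
[folklore] -/
theorem val_shift_mod_four {m : ℕ} (hm : 3 ≤ m) (a : ZMod (2 ^ m)) (ha : a.val % 4 = 1) :
    (a * ((5 : ℕ) : ZMod (2 ^ m))).val % 4 = 1 ∧ (a * ((5 : ℕ) : ZMod (2 ^ m))⁻¹).val % 4 = 1 := by
  have h1 := (four_dvd_two_pow (by omega : 2 ≤ m)).trans (dvd_val_mul_five hm a)
  have h2 := (four_dvd_two_pow (by omega : 2 ≤ m)).trans (dvd_val_mul_five_inv hm a)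
  constructor <;> omega

/-- An `η = +1` class has odd value. [folklore] -/
theorem odd_val_of_mod_four {m : ℕ} (a : ZMod (2 ^ m)) (ha : a.val % 4 = 1) : Odd a.val :=
  Nat.odd_iff.mpr (by omega)

end Classes


end Summit.BirchSwinnertonDyer.BirchSwinnertonDyer.Theorems.DepletionAtTwo

end
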